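import Summits.QuantumFields.BalabanUV.T4Continuum.Spine.NE1p.DressedSmallFieldGeometry
import Summits.QuantumFields.BalabanUV.T4Continuum.Support.B13TermParamGaussianBiProd

/-!
# T⁴ programme, spine estimate NE1′ (node O3b/H2) — THE READING (B1) ON THE CELL'S (2.14)-CORES: the dressed activities'
# analyticity ∕ majorant along a table pencil ((E1)∕(E2) of N0j∕N0k, hitherto the binders `hhol`∕`hm` read off the READING
# `hrep`) DISCHARGED BY NAME from row NE5's structural shape `TermHistExpLinear` — PROVED in the tree for every family of
# (2.14)-cores of the format of record (`B13TermParamGaussianBi.BiCore` ∕ `termBi` — the format in which the substrate's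
# activity slot `SubstrateActivities.actOfLetters` is written) — and the induction face of N0m∕N0o fired with them

Cell `pub-balaban`, sub-cell `t4`, BINDER-OWNERS row NE1′; owner lineage t4-ne1p-p1 (PROVER seat P1, «RG-trajectory comparison …
μ-uniformity through the printed small-field bounds»), generation 27; ADDITIVE — imports N0o `Spine/NE1p/DressedSmallFieldGeometry`
(p221125; → N0m → N0j) and row NE5's `Support/B13TermParamGaussianBiProd` (p216828, ne5-formalise-leaf-08; → `B13TermParamGaussianBi`
p215679 → `OutputRateGaussianParamBi` p214940 → `Literature/…/T4InputCauchyRateTermwise`) ONLY; THEOREMS ONLY (0 def, 0 `def … : Prop`,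
0 cite); nothing of those modules is restated.

WHY THIS FILE (memo g26 §5 (f) «the discharge PATH of (B1)»; t4-ref2 pass 76 C-t4r2-354 (i): (R1)'s linearity PRESUPPOSES the
dressed input meets Lemma 1's input hypotheses).  In N0j∕N0k∕N0m∕N0o the dressed activities of a small-field step enter through
two per-polymer binders along the pencil `s ↦ act s Z`: (E1) `hhol` (complex differentiability in `s`) and (E2) `hm` (a
pencil-free majorant `m Z`), which N0k derives from the READING (B1) `hrep` «each dressed activity is a finite sum of averaged
exp-linear terms `∫ pre·exp(ℓ_ω(table)) dν` with μ-free data, read along the dressed table».  Row NE5 has meanwhile TYPED the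
resummed (2.14)-term of [Balaban1988RGII] p. 15 as a structure — `BiCore` (contour-parameter measure `lam`, Cauchy weight `w`,
operator letters `N`, `q`, characteristic functions `chi`, history read-out `readOut p v : B13HistM P →L[ℂ] ℂ` through the
table space of record) with its term `termAt`∕`termBi` — and PROVED, for every such family, the owner-of-NE5's shape
`TermGaussianParamBi` (`termGaussianParamBi_termBi`, operator letters displayed) and from it the HISTORY-SPECIES STRUCTURAL SHAPE
`T4InputCauchyRateTermwise.TermHistExpLinear` (`OutputRateGaussianParamBi.termHistExpLinear_of_bi`: the term IS
`∫ Φ(a)·exp(Λ(a) h) dμ(a)` with `Φ` integrable, `Λ` weakly measurable and a.e. bounded, data independent of the table `h`) — which is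
(B1) `hrep` in row NE5's letters.  This file plugs the two rows together:
* §1 (kernel, NE5 letters) `differentiableOn_term_curve` ∕ `norm_term_curve_le` — under `TermHistExpLinear K T W μ Φ Λ`, along ANY
  table curve `hc : ℂ → Hist` that is complex differentiable on a set `S` and keeps `(o, hc s)` in the class `K k g U`, every term
  `s ↦ T k i o (hc s) X` is complex differentiable on `S` (the exp-linear integral is ENTIRE in the table —
  `T4InputCauchyRateTermwise.differentiable_integral_mul_cexp_clm` BY NAME) and bounded by the table-free majorant
  `(∫‖Φ‖)·e^{N·R₀}` when `‖hc s‖ ≤ R₀` and `‖Λ‖ ≤ N` a.e. (`norm_integral_mul_cexp_clm_le` BY NAME).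
* §2 (kernel) `differentiableOn_act_of_terms` ∕ `norm_act_le_of_terms` — polymer activities that are finite sums of such terms
  (`act s Z = Σ_{i ∈ terms Z} T k i o (hc s) (emb Z)`, `emb` placing the polymers among the carrier domains of scale `k`) satisfy
  N0j's (E1)∕(E2) with the majorant `m Z = Σ_{i ∈ terms Z} (∫‖Φ_i‖)·e^{N_i R₀}`.
* §3 (kernel) `attachedPart_locE_le_of_expLinear` (and `muPart_locE_le_of_expLinear`, the source-pencil twin over N0o's
  `muPart_locE_le_geom`) — N0o's `attachedPart_locE_le_geom` (N0m §2 over a `B13Resummation.Geometry`) with `hhol`∕`hm`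
  DISCHARGED by §2 along the table-strength pencil: the remaining binders are `TermHistExpLinear` (structural; for
  cores a THEOREM, §4), the pencil inside the class (`hK` — the (w6)∕radius bookkeeping of N0k §3 at the class's history ball), the
  explicit a.e. bounds `N_i` of the read-outs, the (2.38)-shape of the majorant (`hL3` — binder (B3) = GAPS G-ne9p2-5, UNPRINTED,
  shared with NE9; here literally a statement about the parameter masses `∫‖Φ_i‖` of the cores, i.e. row NE5's displayed
  `paramMass`-budget letter), geometry (a `Geometry`, discharged on the torus by pv22∕N0o §2), the clauses, `hϱ`∕`hϱA`.
* §4 (kernel) `termHistExpLinear_termBi` ∕ `attachedPart_locE_le_of_cores` ∕ `attachedPart_locE_le_of_cores_pencil` (linear dressing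
  `h₀ + s•w`: pencil data = two radius inequalities) — ON THE CORES OF RECORD: for any family
  `𝔊 k i X : BiCore P dom Op (β k i) (α k i)` with the operator letters of `termGaussianParamBi_termBi` at the class centres
  (`0 < m`; `N` measurable ∕ holomorphic ∕ bounded on the operator ball; `q` measurable ∕ holomorphic ∕ affine margin — rows NE2∕NE3's
  Gaussian data, DISPLAYED exactly as row NE5 displays them) and a room `ROp < R′`, `TermHistExpLinear` HOLDS for `termBi 𝔊` on the
  ball class (NE5's two theorems composed BY NAME), the read-out bound is the core's letter `N₁ = Σ_Y rad Y·level136` POINTWISE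
  (`BiCore.norm_readOut_le`), and §3 fires: the attached part of the dressed small-field output built from the cores' terms is
  `≤ 4·(e ν c₁ K₀²)·A₁·e^{−r₁ d(X₀)}` with (B1) NO LONGER A BINDER.  The substrate's activity slot of record is written in this
  format — `SubstrateActivities.actOfLetters ℓ Z j o h = (coreOf ℓ Z j).termAt o h` (`actOfLetters_apply`, `rfl`),
  `termBi 𝔊 k i o h X = (𝔊 k i X).termAt o h` (`termBi_eq_termAt`, `rfl`) — and becomes a `termBi` family once the substrate's
  `slotsOfRecord` fixes its polymer ∕ parameter types (cf. `BiCore.comapV`); this file does not import the substrate (the embedding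
  `emb`, the scale clause and the term indexing are the displayed interface).

WHAT THIS DOES TO THE WALL (owner's reading, for the dagwriter ∕ t4-ref2 to grade; nothing re-labelled here).  For activities built
from (2.14)-cores of the format of record, wall v1.6's «(B1) READING `hrep`» splits into (B1a) exp-linearity in the table ⇒
(E1)∕(E2) — a THEOREM of the cores (`TermHistExpLinear`), modulo rows NE2∕NE3's operator letters (the binders row NE5 carries; NOT
new) — and (B1b) the identification of Bałaban's resummed (2.14)-terms at a polymer with a finite family of such cores (`terms Z`,
`emb` — the INDEXING half, = the substrate's dictionary), plus the pencil staying in the class's history ball ((w6)-type radius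
bookkeeping).  (B3) is untouched and now LITERALLY the (2.38)-shape of the cores' parameter masses; (B5), geometry, step-link as
before.  NE1′ NOT printed, NOT proved; 0∕9; count 9 unchanged.

HONEST FRAMING.  By-name compositions over SHAPES and over row NE5's PROVED structural theorems; nothing of Bałaban's densities
instantiated (the cores are the cell's typed FORMAT of (2.14) with letters, not Bałaban's functions; the operator letters, the
parameter-mass budget and the indexing are displayed); [Balaban1988RGII] (2.14) p. 15, (2.18) p. 16, (2.38) p. 20 are LOCI
(TYPE∕CONTEXT) quoted in the imported modules with their tags; ABSOLUTE RULE honoured.  Rung (B)+1 on ONE finite four-torus — NOT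
infinite volume, NOT a mass gap, NOT OS on ℝ⁴, NOT Clay.  HONEST DEPENDENCY: continuum YM on T⁴ ⇐ BetaPertH ∧ nine spine
estimates (0/9 proved); BetaPertH ⇐ (D1) ∧ (D4) ∧ CAP+tail; G-an2-4 gates asym, D1 and NE2/3/4.
-/

noncomputable section

namespace Summit.QuantumFields.BalabanUV.T4Continuum.NE1p.DressedSmallFieldOnCores

open Metric Set Complex MeasureTheory
open scoped BigOperators
open Literature.MathematicalPhysics.QuantumFieldTheory.Balaban1983to89 (LocDomainSys)
open Literature.MathematicalPhysics.QuantumFieldTheory.Balaban1983to89.T4OutputRate (Carriers)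
open Literature.MathematicalPhysics.QuantumFieldTheory.Balaban1983to89.B13Resummation (locE Geometry)
open Literature.MathematicalPhysics.QuantumFieldTheory.Balaban1983to89.T4InputCauchyRateSpecies (ballClass)
open Literature.MathematicalPhysics.QuantumFieldTheory.Balaban1983to89.T4InputCauchyRateTermwise (TermHistExpLinear
  differentiable_integral_mul_cexp_clm norm_integral_mul_cexp_clm_le)
open Summit.QuantumFields.BalabanUV.T4Continuum.B13HistMeasurable (MeasPotFrame B13HistM)
open Summit.QuantumFields.BalabanUV.T4Continuum.B13TermParamGaussianBi (BiCore termBi termGaussianParamBi_termBi)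
open Summit.QuantumFields.BalabanUV.T4Continuum.OutputRateGaussianParamBi (termHistExpLinear_of_bi)
open Summit.QuantumFields.BalabanUV.T4Continuum.NE1p.DressedSmallFieldGeometry (attachedPart_locE_le_geom muPart_locE_le_geom)

/-! ## §1 EXP-LINEAR TERMS ALONG A TABLE CURVE (row NE5's letters): (E1)∕(E2) per term from `TermHistExpLinear` -/

section Curve

variable {C : Carriers} {Op Hist : Type*} [NormedAddCommGroup Hist] [NormedSpace ℂ Hist] {ι : Type*}
  {K : ℕ → (ℕ → ℝ) → C.BgB → Set (Op × Hist)} {T : ℕ → ι → Op → Hist → C.Dom → ℂ}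
  {W : Set (ℕ → ℝ)} {α : ℕ → ι → Type*} [∀ k i, MeasurableSpace (α k i)] {μ : ∀ k i, Op → C.Dom → Measure (α k i)}
  {Φ : ∀ k i, Op → C.Dom → α k i → ℂ} {Λ : ∀ k i, Op → C.Dom → α k i → (Hist →L[ℂ] ℂ)}

/-- **(E1) PER TERM ALONG ANY TABLE CURVE** (kernel): under the structural shape `TermHistExpLinear K T W μ Φ Λ`, at step `k`,
window point `g ∈ W`, background `U`, operator datum `o`: if a table curve `hc` is complex differentiable on `S` and keeps the
point `(o, hc s)` in the class for `s ∈ S`, then `s ↦ T k i o (hc s) X` is complex differentiable on `S` for every domain `X` of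
scale `k` and term `i` — the exp-linear integral is ENTIRE in the table (`differentiable_integral_mul_cexp_clm`) and on the curve's
class points the term IS that integral. [folklore] -/
theorem differentiableOn_term_curve (hexp : TermHistExpLinear K T W μ Φ Λ) {k : ℕ} {g : ℕ → ℝ} (hg : g ∈ W)
    {U : C.BgB} {o : Op} {hc : ℂ → Hist} {S : Set ℂ} (hcurve : DifferentiableOn ℂ hc S)
    (hK : ∀ s ∈ S, (o, hc s) ∈ K k g U) {X : C.Dom} (hX : C.scale X = k) (i : ι) :
    DifferentiableOn ℂ (fun s => T k i o (hc s) X) S := by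
  intro s hs
  obtain ⟨hΦ, hΛm, ⟨N, hN⟩, -⟩ := hexp k g hg U (o, hc s) (hK s hs) X hX i
  have hF := differentiable_integral_mul_cexp_clm hΦ hΛm hN
  refine ((hF _).comp_differentiableWithinAt s (hcurve s hs)).congr (fun s' hs' => ?_) ?_
  · exact (hexp k g hg U (o, hc s') (hK s' hs') X hX i).2.2.2
  · exact (hexp k g hg U (o, hc s) (hK s hs) X hX i).2.2.2

/-- **(E2) PER TERM ALONG ANY TABLE CURVE** (kernel): with an explicit a.e. bound `‖Λ k i o X a‖ ≤ N` of the read-outs and a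
radius `‖hc s‖ ≤ R₀` on `S`, `‖T k i o (hc s) X‖ ≤ (∫‖Φ k i o X‖)·e^{N·R₀}` — a TABLE-FREE majorant (the parameter mass of the
term times the growth of the exp-linear insertion at the radius; `norm_integral_mul_cexp_clm_le`). [folklore] -/
theorem norm_term_curve_le (hexp : TermHistExpLinear K T W μ Φ Λ) {k : ℕ} {g : ℕ → ℝ} (hg : g ∈ W) {U : C.BgB}
    {o : Op} {hc : ℂ → Hist} {S : Set ℂ} (hK : ∀ s ∈ S, (o, hc s) ∈ K k g U) {R₀ : ℝ} (hR : ∀ s ∈ S, ‖hc s‖ ≤ R₀)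
    {X : C.Dom} (hX : C.scale X = k) (i : ι) {N : ℝ} (hN0 : 0 ≤ N) (hN : ∀ᵐ a ∂μ k i o X, ‖Λ k i o X a‖ ≤ N)
    {s : ℂ} (hs : s ∈ S) :
    ‖T k i o (hc s) X‖ ≤ (∫ a, ‖Φ k i o X a‖ ∂μ k i o X) * Real.exp (N * R₀) := by
  obtain ⟨hΦ, -, -, hrep⟩ := hexp k g hg U (o, hc s) (hK s hs) X hX i
  have hrep' : T k i o (hc s) X = ∫ a, Φ k i o X a * cexp (Λ k i o X a (hc s)) ∂μ k i o X := hrep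
  rw [hrep']
  refine (norm_integral_mul_cexp_clm_le hΦ hN (hc s)).trans ?_
  exact mul_le_mul_of_nonneg_left (Real.exp_le_exp.2 (mul_le_mul_of_nonneg_left (hR s hs) hN0))
    (integral_nonneg fun _ => norm_nonneg _)

/-! ## §2 POLYMER ACTIVITIES THAT ARE FINITE SUMS OF SUCH TERMS: N0j's (E1)∕(E2) `hhol`∕`hm` DISCHARGED -/

variable {Dom : Type*} {emb : Dom → C.Dom} {terms : Dom → Finset ι} {act : ℂ → Dom → ℂ}

/-- **(E1) FOR THE ACTIVITIES** (kernel; §1 summed): if every polymer activity along the pencil is the finite sum of its terms at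
the carrier domain `emb Z` of scale `k` — `act s Z = Σ_{i ∈ terms Z} T k i o (hc s) (emb Z)` (the INDEXING half of the reading
(B1): which resummed (2.14)-terms make up the activity of `Z`) — then `s ↦ act s Z` is complex differentiable on `S`. [folklore] -/
theorem differentiableOn_act_of_terms (hexp : TermHistExpLinear K T W μ Φ Λ) {k : ℕ} {g : ℕ → ℝ} (hg : g ∈ W)
    {U : C.BgB} {o : Op} {hc : ℂ → Hist} {S : Set ℂ} (hcurve : DifferentiableOn ℂ hc S)
    (hK : ∀ s ∈ S, (o, hc s) ∈ K k g U) (hscale : ∀ Z, C.scale (emb Z) = k)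
    (hact : ∀ s ∈ S, ∀ Z, act s Z = ∑ i ∈ terms Z, T k i o (hc s) (emb Z)) (Z : Dom) :
    DifferentiableOn ℂ (fun s => act s Z) S := by
  have h : DifferentiableOn ℂ (fun s => ∑ i ∈ terms Z, T k i o (hc s) (emb Z)) S :=
    DifferentiableOn.fun_sum fun i _ => differentiableOn_term_curve hexp hg hcurve hK (hscale Z) i
  exact h.congr fun s hs => hact s hs Z

/-- **(E2) FOR THE ACTIVITIES** (kernel; §1 summed): with explicit a.e. read-out bounds `N Z i ≥ 0` and the radius `R₀` of the
curve on `S`, `‖act s Z‖ ≤ Σ_{i ∈ terms Z} (∫‖Φ k i o (emb Z)‖)·e^{N Z i·R₀}` on `S` — N0j's pencil-free majorant `m Z`.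
[folklore] -/
theorem norm_act_le_of_terms (hexp : TermHistExpLinear K T W μ Φ Λ) {k : ℕ} {g : ℕ → ℝ} (hg : g ∈ W) {U : C.BgB}
    {o : Op} {hc : ℂ → Hist} {S : Set ℂ} (hK : ∀ s ∈ S, (o, hc s) ∈ K k g U) {R₀ : ℝ} (hR : ∀ s ∈ S, ‖hc s‖ ≤ R₀)
    (hscale : ∀ Z, C.scale (emb Z) = k) (hact : ∀ s ∈ S, ∀ Z, act s Z = ∑ i ∈ terms Z, T k i o (hc s) (emb Z))
    {N : Dom → ι → ℝ} (hN0 : ∀ Z i, 0 ≤ N Z i) (hN : ∀ Z, ∀ i ∈ terms Z, ∀ᵐ a ∂μ k i o (emb Z), ‖Λ k i o (emb Z) a‖ ≤ N Z i)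
    {s : ℂ} (hs : s ∈ S) (Z : Dom) :
    ‖act s Z‖ ≤ ∑ i ∈ terms Z, (∫ a, ‖Φ k i o (emb Z) a‖ ∂μ k i o (emb Z)) * Real.exp (N Z i * R₀) := by
  rw [hact s hs Z]
  exact (norm_sum_le _ _).trans
    (Finset.sum_le_sum fun i hi => norm_term_curve_le hexp hg hK hR (hscale Z) i (hN0 Z i) (hN Z i hi) hs)

end Curve

/-! ## §3 THE INDUCTION FACE WITH (B1) DISCHARGED BY THE STRUCTURAL SHAPE: N0o's `attachedPart_locE_le_geom` fired with §2 -/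

section Induction

variable {C : Carriers} {Op Hist : Type*} [NormedAddCommGroup Hist] [NormedSpace ℂ Hist] {ι : Type*}
  {K : ℕ → (ℕ → ℝ) → C.BgB → Set (Op × Hist)} {T : ℕ → ι → Op → Hist → C.Dom → ℂ}
  {W : Set (ℕ → ℝ)} {α : ℕ → ι → Type*} [∀ k i, MeasurableSpace (α k i)] {μ : ∀ k i, Op → C.Dom → Measure (α k i)}
  {Φ : ∀ k i, Op → C.Dom → α k i → ℂ} {Λ : ∀ k i, Op → C.Dom → α k i → (Hist →L[ℂ] ℂ)}
variable (D : LocDomainSys) {Cube : Type} [DecidableEq Cube] (G : Geometry D Cube)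

open Classical in
/-- **THE ATTACHED PART OF THE DRESSED SMALL-FIELD OUTPUT, (B1) DISCHARGED** (kernel; N0o `attachedPart_locE_le_geom` = N0m §2 over
a `B13Resummation.Geometry`, with (E1)∕(E2) supplied by §2 along the table-strength pencil `s ↦ hc s`, `‖s‖ < ϱ`).  Binders left,
all displayed: the structural shape `hexp : TermHistExpLinear K T W μ Φ Λ` (a THEOREM for cores, §4); the pencil complex
differentiable on the disc (`hcurve`; for the linear dressing `hc s = h₀ + s•w` automatic) and inside the class (`hK`) with table
radius `R₀` (`hR`); the carrier placement of the polymers (`hscale`) and the indexing of their terms (`hact`); explicit a.e.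
read-out bounds (`hN`); the (2.38)-shape of the resulting majorant at the affine constant, `hL3` — binder (B3) = GAPS G-ne9p2-5
(UNPRINTED, shared with NE9), now LITERALLY about the cores' parameter masses `∫‖Φ_i‖`; the clauses `hrate`∕`hsmall`, `5r₁ ≤ b`,
and N0m's radius conditions `hϱ`∕`hϱA`.  Conclusion: `‖E[act 1](X₀) − E[act 0](X₀)‖ ≤ 4·(e ν c₁ K₀²)·A₁·e^{−r₁ d(X₀)}`.
[folklore] -/
theorem attachedPart_locE_le_of_expLinear (hexp : TermHistExpLinear K T W μ Φ Λ) {k : ℕ} {g : ℕ → ℝ} (hg : g ∈ W)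
    {U : C.BgB} {o : Op} {hc : ℂ → Hist} {ϱ R₀ : ℝ} (hcurve : DifferentiableOn ℂ hc (ball (0 : ℂ) ϱ))
    (hK : ∀ s ∈ ball (0 : ℂ) ϱ, (o, hc s) ∈ K k g U) (hR : ∀ s ∈ ball (0 : ℂ) ϱ, ‖hc s‖ ≤ R₀)
    {emb : D.Dom → C.Dom} (hscale : ∀ Z, C.scale (emb Z) = k) {terms : D.Dom → Finset ι} {act : ℂ → D.Dom → ℂ}
    (hact : ∀ s ∈ ball (0 : ℂ) ϱ, ∀ Z, act s Z = ∑ i ∈ terms Z, T k i o (hc s) (emb Z)) {N : D.Dom → ι → ℝ}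
    (hN0 : ∀ Z i, 0 ≤ N Z i) (hN : ∀ Z, ∀ i ∈ terms Z, ∀ᵐ a ∂μ k i o (emb Z), ‖Λ k i o (emb Z) a‖ ≤ N Z i)
    {A₀ A₁ R r₁ b : ℝ} {X₀ : D.Dom} (hA₀ : 0 ≤ A₀) (hA₁ : 0 ≤ A₁) (hr₁ : 0 ≤ r₁) (hb : r₁ * 5 ≤ b)
    (hrate : r₁ + 2 * G.κ₀ + 2 ≤ R) (hsmall : (A₀ + ϱ * A₁) * Real.exp (b + 1) * G.K₀ * G.ν * G.c₁ ≤ 1)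
    (hL3 : ∀ Z, G.cubes Z ⊆ G.cubes X₀ →
      ∑ i ∈ terms Z, (∫ a, ‖Φ k i o (emb Z) a‖ ∂μ k i o (emb Z)) * Real.exp (N Z i * R₀) ≤
        (A₀ + ϱ * A₁) * Real.exp (-(R * D.dj Z)))
    (hϱ : 2 ≤ ϱ) (hϱA : A₀ ≤ ϱ * A₁) :
    ‖locE G.ι G.cubes (act 1) (G.cubes X₀) - locE G.ι G.cubes (act 0) (G.cubes X₀)‖ ≤
      4 * (Real.exp 1 * G.ν * G.c₁ * G.K₀ ^ 2) * A₁ * Real.exp (-(r₁ * D.dj X₀)) :=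
  attachedPart_locE_le_geom D G hA₀ hA₁ hr₁ hb hrate hsmall
    (fun Z _ => differentiableOn_act_of_terms hexp hg hcurve hK hscale hact Z)
    (fun _ hs Z _ => norm_act_le_of_terms hexp hg hK hR hscale hact hN0 hN hs Z) hL3 hϱ hϱA

open Classical in
/-- **THE μ-PART (SOURCE PENCIL) WITH (B1) DISCHARGED** (kernel; N0o `muPart_locE_le_geom` = N0j §1 over a `Geometry`, (E1)∕(E2)
from §2 along a SOURCE pencil `s ↦ hc s`, `‖s‖ < μ₁` — e.g. the first dressed step's `hc s = 𝐕₀ + s • O`): for `0 < μ₀ < μ₁` and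
`‖μ‖ ≤ μ₀`, `‖E[act μ](X₀) − E[act 0](X₀)‖ ≤ (e ν c₁ K₀²·A·e^{−r₁ d(X₀)})·μ₀/(μ₁ − μ₀)`, the binders being those of
`attachedPart_locE_le_of_expLinear` with the (2.38)-majorant at the constant `A`. [folklore] -/
theorem muPart_locE_le_of_expLinear (hexp : TermHistExpLinear K T W μ Φ Λ) {k : ℕ} {g : ℕ → ℝ} (hg : g ∈ W)
    {U : C.BgB} {o : Op} {hc : ℂ → Hist} {μ₁ R₀ : ℝ} (hcurve : DifferentiableOn ℂ hc (ball (0 : ℂ) μ₁))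
    (hK : ∀ s ∈ ball (0 : ℂ) μ₁, (o, hc s) ∈ K k g U) (hR : ∀ s ∈ ball (0 : ℂ) μ₁, ‖hc s‖ ≤ R₀)
    {emb : D.Dom → C.Dom} (hscale : ∀ Z, C.scale (emb Z) = k) {terms : D.Dom → Finset ι} {act : ℂ → D.Dom → ℂ}
    (hact : ∀ s ∈ ball (0 : ℂ) μ₁, ∀ Z, act s Z = ∑ i ∈ terms Z, T k i o (hc s) (emb Z)) {N : D.Dom → ι → ℝ}
    (hN0 : ∀ Z i, 0 ≤ N Z i) (hN : ∀ Z, ∀ i ∈ terms Z, ∀ᵐ a ∂μ k i o (emb Z), ‖Λ k i o (emb Z) a‖ ≤ N Z i)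
    {A R r₁ b μ₀ : ℝ} {X₀ : D.Dom} {sμ : ℂ} (hA : 0 ≤ A) (hr₁ : 0 ≤ r₁) (hb : r₁ * 5 ≤ b)
    (hrate : r₁ + 2 * G.κ₀ + 2 ≤ R) (hsmall : A * Real.exp (b + 1) * G.K₀ * G.ν * G.c₁ ≤ 1)
    (hL3 : ∀ Z, G.cubes Z ⊆ G.cubes X₀ →
      ∑ i ∈ terms Z, (∫ a, ‖Φ k i o (emb Z) a‖ ∂μ k i o (emb Z)) * Real.exp (N Z i * R₀) ≤ A * Real.exp (-(R * D.dj Z)))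
    (h0 : 0 < μ₀) (h01 : μ₀ < μ₁) (hμ : ‖sμ‖ ≤ μ₀) :
    ‖locE G.ι G.cubes (act sμ) (G.cubes X₀) - locE G.ι G.cubes (act 0) (G.cubes X₀)‖ ≤
      Real.exp 1 * G.ν * G.c₁ * G.K₀ ^ 2 * A * Real.exp (-(r₁ * D.dj X₀)) * (μ₀ / (μ₁ - μ₀)) :=
  muPart_locE_le_geom D G hA hr₁ hb hrate hsmall
    (fun Z _ => differentiableOn_act_of_terms hexp hg hcurve hK hscale hact Z)
    (fun _ hs Z _ => norm_act_le_of_terms hexp hg hK hR hscale hact hN0 hN hs Z) hL3 h0 h01 hμ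

end Induction

section Pencil

variable {C : Carriers} {Op Hist : Type*} [NormedAddCommGroup Op] [NormedAddCommGroup Hist] [NormedSpace ℂ Hist]

/-- **THE LINEAR DRESSING STAYS IN A BALL CLASS** [folklore]: for the table-strength pencil `hc s = h₀ + s • w` and a ball class
of history radius `RHist` about the centre `ctr.2`, the pencil keeps `(o, hc s)` in the class for `‖s‖ < ϱ` as soon as
`‖o − ctr.1‖ ≤ ROp` and `‖h₀ − ctr.2‖ + ϱ·‖w‖ ≤ RHist` — the radius bookkeeping «ε₁ ↦ ε₁ + (size of the attached part)» of N0k §3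
at the class of record (this is where the (w6) source window enters: `w = 𝐖_k(μ)` has size ∝ |μ|). -/
theorem pencil_mem_ballClass {ctr : ℕ → (ℕ → ℝ) → C.BgB → Op × Hist} {ROp RHist : ℕ → ℝ} {k : ℕ} {g : ℕ → ℝ}
    {U : C.BgB} {o : Op} {h₀ w : Hist} {ϱ : ℝ} (hO : ‖o - (ctr k g U).1‖ ≤ ROp k)
    (hH : ‖h₀ - (ctr k g U).2‖ + ϱ * ‖w‖ ≤ RHist k) {s : ℂ} (hs : s ∈ ball (0 : ℂ) ϱ) :
    (o, h₀ + s • w) ∈ ballClass ctr ROp RHist k g U := by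
  refine Set.mk_mem_prod (mem_closedBall.2 (by rwa [dist_eq_norm])) (mem_closedBall.2 ?_)
  rw [dist_eq_norm, mem_ball_zero_iff] at *
  calc ‖h₀ + s • w - (ctr k g U).2‖ = ‖(h₀ - (ctr k g U).2) + s • w‖ := by congr 1; abel
    _ ≤ ‖h₀ - (ctr k g U).2‖ + ‖s • w‖ := norm_add_le _ _
    _ ≤ ‖h₀ - (ctr k g U).2‖ + ϱ * ‖w‖ := by
        rw [norm_smul]; gcongr
    _ ≤ RHist k := hH

/-- The linear dressing has table radius `‖h₀‖ + ϱ‖w‖` on the disc `‖s‖ < ϱ`. [folklore] -/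
theorem norm_pencil_le {h₀ w : Hist} {ϱ : ℝ} {s : ℂ} (hs : s ∈ ball (0 : ℂ) ϱ) : ‖h₀ + s • w‖ ≤ ‖h₀‖ + ϱ * ‖w‖ := by
  rw [mem_ball_zero_iff] at hs
  calc ‖h₀ + s • w‖ ≤ ‖h₀‖ + ‖s • w‖ := norm_add_le _ _
    _ ≤ ‖h₀‖ + ϱ * ‖w‖ := by rw [norm_smul]; gcongr

end Pencil

/-! ## §4 ON THE (2.14)-CORES OF THE FORMAT OF RECORD: `TermHistExpLinear` is a THEOREM (row NE5), the read-out bound is the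
core's letter `N₁`, and §3 fires — (B1) is no longer a binder for activities built from cores -/

section Cores

variable {C : Carriers} {P : MeasPotFrame C} {𝒴 : Type*} {dom : 𝒴 → C.Dom} {Op : Type*} [NormedAddCommGroup Op]
  [NormedSpace ℂ Op] {ι : Type*} {β : ℕ → ι → Type*} [∀ k i, MeasurableSpace (β k i)] {α : ℕ → ι → Type*}
  [∀ k i, NormedAddCommGroup (α k i)] [∀ k i, InnerProductSpace ℝ (α k i)] [∀ k i, FiniteDimensional ℝ (α k i)]
  [∀ k i, MeasurableSpace (α k i)] [∀ k i, BorelSpace (α k i)]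

/-- **`TermHistExpLinear` HOLDS FOR THE CORES' TERMS** (kernel; row NE5's `termGaussianParamBi_termBi` and
`termHistExpLinear_of_bi` composed BY NAME): for a family of cores `𝔊 k i X` with the operator letters at the class centres' operator
balls of radius `R′ k` (`hm`, `hN`, `hq` — LITERALLY the binders of `termGaussianParamBi_termBi`) and a room `ROp k < R′ k`, the
terms `termBi 𝔊` are exp-linear in the table on the ball class `ballClass ctr ROp RHist`, with reference measures
`lam ⊗ volume`, densities `w(p)N(o,p)·(chi(v)e^{−q(o,p,v)})` and read-outs `readOut p v`.  For the substrate's activity slot of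
record (`actOfLetters ℓ Z j o h = (coreOf ℓ Z j).termAt o h`, `termBi_eq_termAt`) this is the statement to instantiate once its polymer ∕
parameter types are fixed. [folklore] -/
theorem termHistExpLinear_termBi {W : Set (ℕ → ℝ)} {ctr : ℕ → (ℕ → ℝ) → C.BgB → Op × B13HistM P}
    {ROp RHist R' : ℕ → ℝ} (𝔊 : ∀ k i, C.Dom → BiCore P dom Op (β k i) (α k i)) {m b N₀ : ℕ → ι → C.Dom → ℝ}
    (hroom : ∀ k, ROp k < R' k)
    (hm : ∀ k, ∀ g ∈ W, ∀ (U : C.BgB) (X : C.Dom), C.scale X = k → ∀ i, 0 < m k i X)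
    (hN : ∀ k, ∀ g ∈ W, ∀ (U : C.BgB) (X : C.Dom), C.scale X = k → ∀ i,
      (∀ o ∈ ball (ctr k g U).1 (R' k), AEStronglyMeasurable ((𝔊 k i X).N o) (𝔊 k i X).lam) ∧
      (∀ p, DifferentiableOn ℂ (fun o => (𝔊 k i X).N o p) (ball (ctr k g U).1 (R' k))) ∧
      (∀ o ∈ ball (ctr k g U).1 (R' k), ∀ p, ‖(𝔊 k i X).N o p‖ ≤ N₀ k i X))
    (hq : ∀ k, ∀ g ∈ W, ∀ (U : C.BgB) (X : C.Dom), C.scale X = k → ∀ i,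
      (∀ o ∈ ball (ctr k g U).1 (R' k),
        AEStronglyMeasurable (Function.uncurry ((𝔊 k i X).q o)) ((𝔊 k i X).lam.prod volume)) ∧
      (∀ p v, DifferentiableOn ℂ (fun o => (𝔊 k i X).q o p v) (ball (ctr k g U).1 (R' k))) ∧
      (∀ o ∈ ball (ctr k g U).1 (R' k), ∀ p v, m k i X * ‖v‖ ^ 2 - b k i X ≤ ((𝔊 k i X).q o p v).re)) :
    TermHistExpLinear (ballClass ctr ROp RHist) (termBi 𝔊) W
      (fun k i (_ : Op) X => ((𝔊 k i X).lam).prod (volume : Measure (α k i)))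
      (fun k i o X z => (𝔊 k i X).w z.1 * (𝔊 k i X).N o z.1 * ((𝔊 k i X).chi z.2 * cexp (-(𝔊 k i X).q o z.1 z.2)))
      fun k i _ X z => (𝔊 k i X).readOut z.1 z.2 :=
  termHistExpLinear_of_bi (T := termBi 𝔊) (F₀ := fun k i X _ v => (𝔊 k i X).chi v) hroom
    (termGaussianParamBi_termBi 𝔊 hm hN hq)

variable (D : LocDomainSys) {Cube : Type} [DecidableEq Cube] (G : Geometry D Cube)

open Classical in
/-- **THE ATTACHED PART OF THE DRESSED SMALL-FIELD OUTPUT BUILT FROM (2.14)-CORES — (B1) IS NO LONGER A BINDER** (kernel; §3 with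
`hexp` DISCHARGED by `termHistExpLinear_termBi` and the read-out bounds DISCHARGED by the cores' letter `N₁` —
`BiCore.norm_readOut_le`, POINTWISE, `BiCore.N₁_nonneg`).  What remains displayed: the operator letters at the class centres
(`hm`∕`hN`∕`hq`, rows NE2∕NE3's Gaussian data — row NE5's binders verbatim) and the room `hroom`; the table pencil `hc` on the
disc `‖s‖ < ϱ` (complex differentiable, inside the ball class — `pencil_mem_ballClass` for the linear dressing —, table radius
`R₀`); the carrier placement `hscale` and the term indexing `hact` (`act s Z = Σ_{i ∈ terms Z} termBi 𝔊 k i o (hc s) (emb Z)`);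
geometry `G` (discharged on the torus by pv22); the clauses `hrate`∕`hsmall` at the affine constant, `5r₁ ≤ b₅`; N0m's radius
conditions `hϱ`∕`hϱA`; and (B3) `hL3` — NOW LITERALLY «the parameter masses of the cores, weighted by `e^{N₁ R₀}` and summed over
the terms of each polymer inside `X₀`, have the (2.38)-shape `(A₀ + ϱA₁)·e^{−R d(Z)}`» (GAPS G-ne9p2-5, UNPRINTED, shared with
NE9; row NE5's `paramMass`-budget letter).  Conclusion: `‖E[act 1](X₀) − E[act 0](X₀)‖ ≤ 4·(e ν c₁ K₀²)·A₁·e^{−r₁ d(X₀)}`.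
[folklore] -/
theorem attachedPart_locE_le_of_cores {W : Set (ℕ → ℝ)} {ctr : ℕ → (ℕ → ℝ) → C.BgB → Op × B13HistM P}
    {ROp RHist R' : ℕ → ℝ} (𝔊 : ∀ k i, C.Dom → BiCore P dom Op (β k i) (α k i)) {mq bq N₀ : ℕ → ι → C.Dom → ℝ}
    (hroom : ∀ k, ROp k < R' k)
    (hm : ∀ k, ∀ g ∈ W, ∀ (U : C.BgB) (X : C.Dom), C.scale X = k → ∀ i, 0 < mq k i X)
    (hN : ∀ k, ∀ g ∈ W, ∀ (U : C.BgB) (X : C.Dom), C.scale X = k → ∀ i,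
      (∀ o ∈ ball (ctr k g U).1 (R' k), AEStronglyMeasurable ((𝔊 k i X).N o) (𝔊 k i X).lam) ∧
      (∀ p, DifferentiableOn ℂ (fun o => (𝔊 k i X).N o p) (ball (ctr k g U).1 (R' k))) ∧
      (∀ o ∈ ball (ctr k g U).1 (R' k), ∀ p, ‖(𝔊 k i X).N o p‖ ≤ N₀ k i X))
    (hq : ∀ k, ∀ g ∈ W, ∀ (U : C.BgB) (X : C.Dom), C.scale X = k → ∀ i,
      (∀ o ∈ ball (ctr k g U).1 (R' k),
        AEStronglyMeasurable (Function.uncurry ((𝔊 k i X).q o)) ((𝔊 k i X).lam.prod volume)) ∧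
      (∀ p v, DifferentiableOn ℂ (fun o => (𝔊 k i X).q o p v) (ball (ctr k g U).1 (R' k))) ∧
      (∀ o ∈ ball (ctr k g U).1 (R' k), ∀ p v, mq k i X * ‖v‖ ^ 2 - bq k i X ≤ ((𝔊 k i X).q o p v).re))
    {k : ℕ} {g : ℕ → ℝ} (hg : g ∈ W) {U : C.BgB} {o : Op} {hc : ℂ → B13HistM P} {ϱ R₀ : ℝ}
    (hcurve : DifferentiableOn ℂ hc (ball (0 : ℂ) ϱ))
    (hK : ∀ s ∈ ball (0 : ℂ) ϱ, (o, hc s) ∈ ballClass ctr ROp RHist k g U) (hR : ∀ s ∈ ball (0 : ℂ) ϱ, ‖hc s‖ ≤ R₀)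
    {emb : D.Dom → C.Dom} (hscale : ∀ Z, C.scale (emb Z) = k) {terms : D.Dom → Finset ι} {act : ℂ → D.Dom → ℂ}
    (hact : ∀ s ∈ ball (0 : ℂ) ϱ, ∀ Z, act s Z = ∑ i ∈ terms Z, termBi 𝔊 k i o (hc s) (emb Z))
    {A₀ A₁ R r₁ b₅ : ℝ} {X₀ : D.Dom} (hA₀ : 0 ≤ A₀) (hA₁ : 0 ≤ A₁) (hr₁ : 0 ≤ r₁) (hb : r₁ * 5 ≤ b₅)
    (hrate : r₁ + 2 * G.κ₀ + 2 ≤ R) (hsmall : (A₀ + ϱ * A₁) * Real.exp (b₅ + 1) * G.K₀ * G.ν * G.c₁ ≤ 1)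
    (hL3 : ∀ Z, G.cubes Z ⊆ G.cubes X₀ →
      ∑ i ∈ terms Z, (∫ z, ‖(𝔊 k i (emb Z)).w z.1 * (𝔊 k i (emb Z)).N o z.1 *
          ((𝔊 k i (emb Z)).chi z.2 * cexp (-(𝔊 k i (emb Z)).q o z.1 z.2))‖ ∂((𝔊 k i (emb Z)).lam.prod volume)) *
        Real.exp ((𝔊 k i (emb Z)).N₁ * R₀) ≤ (A₀ + ϱ * A₁) * Real.exp (-(R * D.dj Z)))
    (hϱ : 2 ≤ ϱ) (hϱA : A₀ ≤ ϱ * A₁) :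
    ‖locE G.ι G.cubes (act 1) (G.cubes X₀) - locE G.ι G.cubes (act 0) (G.cubes X₀)‖ ≤
      4 * (Real.exp 1 * G.ν * G.c₁ * G.K₀ ^ 2) * A₁ * Real.exp (-(r₁ * D.dj X₀)) :=
  attachedPart_locE_le_of_expLinear D G (termHistExpLinear_termBi 𝔊 hroom hm hN hq) hg hcurve hK hR hscale hact
    (fun Z i => (𝔊 k i (emb Z)).N₁_nonneg)
    (fun Z i _ => Filter.Eventually.of_forall fun z => (𝔊 k i (emb Z)).norm_readOut_le z.1 z.2)
    hA₀ hA₁ hr₁ hb hrate hsmall hL3 hϱ hϱA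

open Classical in
/-- **THE SAME ALONG THE LINEAR TABLE-STRENGTH PENCIL `s ↦ h₀ + s • w`** (kernel; the pencil's differentiability, class membership
and radius DISCHARGED by `pencil_mem_ballClass` ∕ `norm_pencil_le`): the only pencil data left are the two radius inequalities
`‖o − ctr.1‖ ≤ ROp k` and `‖h₀ − ctr.2‖ + ϱ·‖w‖ ≤ RHist k` — the undressed table `h₀` plus the attached table `w = 𝐖_k(μ)`
inflated by the pencil radius stays in the class's history ball («ε₁ ↦ ε₁ + (size of the attached part)», N0k §3; the (w6) window
enters through `‖w‖ ∝ |μ|`); the table radius is `R₀ := ‖h₀‖ + ϱ·‖w‖`. [folklore] -/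
theorem attachedPart_locE_le_of_cores_pencil {W : Set (ℕ → ℝ)} {ctr : ℕ → (ℕ → ℝ) → C.BgB → Op × B13HistM P}
    {ROp RHist R' : ℕ → ℝ} (𝔊 : ∀ k i, C.Dom → BiCore P dom Op (β k i) (α k i)) {mq bq N₀ : ℕ → ι → C.Dom → ℝ}
    (hroom : ∀ k, ROp k < R' k)
    (hm : ∀ k, ∀ g ∈ W, ∀ (U : C.BgB) (X : C.Dom), C.scale X = k → ∀ i, 0 < mq k i X)
    (hN : ∀ k, ∀ g ∈ W, ∀ (U : C.BgB) (X : C.Dom), C.scale X = k → ∀ i,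
      (∀ o ∈ ball (ctr k g U).1 (R' k), AEStronglyMeasurable ((𝔊 k i X).N o) (𝔊 k i X).lam) ∧
      (∀ p, DifferentiableOn ℂ (fun o => (𝔊 k i X).N o p) (ball (ctr k g U).1 (R' k))) ∧
      (∀ o ∈ ball (ctr k g U).1 (R' k), ∀ p, ‖(𝔊 k i X).N o p‖ ≤ N₀ k i X))
    (hq : ∀ k, ∀ g ∈ W, ∀ (U : C.BgB) (X : C.Dom), C.scale X = k → ∀ i,
      (∀ o ∈ ball (ctr k g U).1 (R' k),
        AEStronglyMeasurable (Function.uncurry ((𝔊 k i X).q o)) ((𝔊 k i X).lam.prod volume)) ∧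
      (∀ p v, DifferentiableOn ℂ (fun o => (𝔊 k i X).q o p v) (ball (ctr k g U).1 (R' k))) ∧
      (∀ o ∈ ball (ctr k g U).1 (R' k), ∀ p v, mq k i X * ‖v‖ ^ 2 - bq k i X ≤ ((𝔊 k i X).q o p v).re))
    {k : ℕ} {g : ℕ → ℝ} (hg : g ∈ W) {U : C.BgB} {o : Op} {h₀ w : B13HistM P} {ϱ : ℝ}
    (hO : ‖o - (ctr k g U).1‖ ≤ ROp k) (hH : ‖h₀ - (ctr k g U).2‖ + ϱ * ‖w‖ ≤ RHist k)
    {emb : D.Dom → C.Dom} (hscale : ∀ Z, C.scale (emb Z) = k) {terms : D.Dom → Finset ι} {act : ℂ → D.Dom → ℂ}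
    (hact : ∀ s ∈ ball (0 : ℂ) ϱ, ∀ Z, act s Z = ∑ i ∈ terms Z, termBi 𝔊 k i o (h₀ + s • w) (emb Z))
    {A₀ A₁ R r₁ b₅ : ℝ} {X₀ : D.Dom} (hA₀ : 0 ≤ A₀) (hA₁ : 0 ≤ A₁) (hr₁ : 0 ≤ r₁) (hb : r₁ * 5 ≤ b₅)
    (hrate : r₁ + 2 * G.κ₀ + 2 ≤ R) (hsmall : (A₀ + ϱ * A₁) * Real.exp (b₅ + 1) * G.K₀ * G.ν * G.c₁ ≤ 1)
    (hL3 : ∀ Z, G.cubes Z ⊆ G.cubes X₀ →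
      ∑ i ∈ terms Z, (∫ z, ‖(𝔊 k i (emb Z)).w z.1 * (𝔊 k i (emb Z)).N o z.1 *
          ((𝔊 k i (emb Z)).chi z.2 * cexp (-(𝔊 k i (emb Z)).q o z.1 z.2))‖ ∂((𝔊 k i (emb Z)).lam.prod volume)) *
        Real.exp ((𝔊 k i (emb Z)).N₁ * (‖h₀‖ + ϱ * ‖w‖)) ≤ (A₀ + ϱ * A₁) * Real.exp (-(R * D.dj Z)))
    (hϱ : 2 ≤ ϱ) (hϱA : A₀ ≤ ϱ * A₁) :
    ‖locE G.ι G.cubes (act 1) (G.cubes X₀) - locE G.ι G.cubes (act 0) (G.cubes X₀)‖ ≤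
      4 * (Real.exp 1 * G.ν * G.c₁ * G.K₀ ^ 2) * A₁ * Real.exp (-(r₁ * D.dj X₀)) :=
  attachedPart_locE_le_of_cores D G 𝔊 hroom hm hN hq hg (hc := fun s => h₀ + s • w)
    ((differentiable_const h₀).add (differentiable_id.smul_const w)).differentiableOn
    (fun _ hs => pencil_mem_ballClass hO hH hs) (fun _ hs => norm_pencil_le hs) hscale hact hA₀ hA₁ hr₁ hb hrate hsmall
    hL3 hϱ hϱA

end Cores

/-! ## §5 NON-VACUITY OF §1 ON ROW NE5's OWN DECIDED TOY (a THEOREM-backed instance of the shape, not a definitional one) -/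
section Toy

open Literature.MathematicalPhysics.QuantumFieldTheory.Balaban1983to89.T4InputCauchyRate (toyCarriers)
open Literature.MathematicalPhysics.QuantumFieldTheory.Balaban1983to89.T4InputCauchyRateSpecies (toyCtr)
open Literature.MathematicalPhysics.QuantumFieldTheory.Balaban1983to89.T4InputCauchyRateTermwise (toyTermD
  toyD_termHistExpLinear)

/-- §1's (E1) FIRES on row NE5's toy `toyD_termHistExpLinear` (terms `exp(o + h)` and `−1`, ball class of radii `(1/8, 2)`
about the centre `(0, 0)`, window `univ`): along the table pencil `s ↦ s • 1` of radius `2` at the operator datum `o = 0`, every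
term is complex differentiable on `‖s‖ < 2` — from the STRUCTURAL shape alone, exactly as the cores' terms in §4. [folklore] -/
example (k : ℕ) (g : ℕ → ℝ) (i : Fin 2) :
    DifferentiableOn ℂ (fun s : ℂ => toyTermD k i 0 (s • (1 : ℂ)) k) (ball (0 : ℂ) 2) :=
  differentiableOn_term_curve (K := ballClass toyCtr (fun _ => 1 / 8) fun _ => 2) (U := ()) (hc := fun s : ℂ => s • (1 : ℂ))
    toyD_termHistExpLinear (Set.mem_univ g) ((differentiable_id.smul_const (1 : ℂ)).differentiableOn)
    (fun s hs => by
      refine Set.mk_mem_prod (mem_closedBall.2 ?_) (mem_closedBall.2 ?_)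
      · simp [toyCtr]
      · rw [mem_ball_zero_iff] at hs
        simpa [toyCtr, dist_eq_norm] using hs.le)
    (X := k) rfl i

end Toy

end Summit.QuantumFields.BalabanUV.T4Continuum.NE1p.DressedSmallFieldOnCores

end
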